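import Summits.Schanuel.Schanuel.Theorems.ZilberEacAlgebraicLogTranscendence
import Summits.Schanuel.Schanuel.Theorems.ZilberEacBranchAlgebraic
import HarnessLib

/-!
# The equimodular class, XLIV: fibre curves with ONE simple nonzero top-row root and an unramified
# zero or pole are dense over polynomial graphs — reciprocal fibres of `y₀`-degree `3` included

HONEST FRAMING.  Cell `pub-schanuel` (Zilber's Exponential-Algebraic Closedness, case ladder;
host summit Schanuel), seat 2, gen 25.  **`unprojectedDense_graph_unramifiedBranch`**: let
`p ∈ ℂ[X]` have degree `≥ 2`, let `P(x₀, y₀) = Q(x₀)(y₀)` be irreducible with rows of degree `≤ N`,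
and let the top row `T = Σ_j [x₀^N]q_j X^j` have SOME simple nonzero root `θ`.  If the fibre curve
`Q = 0` has an unramified zero (`q₀(a) = 0 ≠ q₁(a)` for some `a`) or an unramified pole
(`q₀ ≠ 0`, `q_r(a) = 0 ≠ q_{r-1}(a)`, `r = deg_t Q`), then `{x₁ = p(x₀), P = 0}` has Zariski-dense
exponential points.  Proof: non-density makes `log(ψ_θ(1/z)/θ)` algebraic over `ℂ(z)` along the
branch `ρ = ψ_θ(1/z)` (file XXVII), contradicting the transcendence theorem of file XLIII.  Unlike
THEOREM EB (file XXIX) no Vieta/trace trick is used, so the extreme rows MAY be proportional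
(`q₀ = c·q_r`, the reciprocal type) and the other top-row roots MAY be multiple: in particular
(**`unprojectedDense_graph_reciprocalCubic`**) EVERY irreducible reciprocal-type fibre of
`y₀`-degree `3` with a simple nonzero top-row root is dense (irreducibility forces `q₁(a) ≠ 0` or
`q₂(a) ≠ 0` at any common root `a` of `q₀ = c q₃` and `q₃`).  Complete classes of instances of an
OPEN question (Mantova–Masser, PLMS 2024 §1 p. 5); EC(3,2) OPEN; NOT Schanuel's conjecture (neither
used nor implied; EAC ⇏ SC).
-/

noncomputable section

open Filter Topology Set Complex MvPolynomial
open Literature.NumberTheory.Transcendental Literature.ModelTheory.Zilber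
open Literature.ModelTheory.ExponentialFields

set_option linter.dupNamespace false

namespace Summit.Schanuel.Schanuel.Theorems

/-- A nonzero polynomial with a root has positive degree. [folklore] -/
theorem natDegree_ne_zero_of_isRoot {T : Polynomial ℂ} (hT0 : T ≠ 0) {θ : ℂ} (hTθ : T.IsRoot θ) :
    T.natDegree ≠ 0 := by
  intro h
  have hC := Polynomial.eq_C_of_natDegree_eq_zero h
  rw [hC, Polynomial.IsRoot, Polynomial.eval_C] at hTθ
  apply hT0
  rw [hC, hTθ, map_zero]

/-- **Fibre curves with a simple nonzero top-row root and an unramified zero or pole are dense over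
polynomial graphs of degree `≥ 2`.**  See the module docstring.
[cite: MantovaMasser2023, §1 Further remarks, p. 5 (the question, open in general)] (new) -/
theorem unprojectedDense_graph_unramifiedBranch (Q : Polynomial (Polynomial ℂ))
    {P : MvPolynomial (Fin 2) ℂ}
    (hP : ∀ x y : ℂ, MvPolynomial.eval ![x, y] P = (Q.map (Polynomial.evalRingHom x)).eval y)
    (hirr : Irreducible P) (N : ℕ) (hN : ∀ j, (Q.coeff j).natDegree ≤ N) (T : Polynomial ℂ)
    (hT : ∀ j, T.coeff j = (Q.coeff j).coeff N) (hT0 : T ≠ 0) {θ : ℂ} (hθ0 : θ ≠ 0)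
    (hTθ : T.IsRoot θ) (hT'θ : (Polynomial.derivative T).eval θ ≠ 0)
    (hpt : (∃ a : ℂ, (Q.coeff 0).IsRoot a ∧ ¬ (Q.coeff 1).IsRoot a) ∨
      (Q.coeff 0 ≠ 0 ∧ ∃ a : ℂ, (Q.coeff Q.natDegree).IsRoot a ∧ ¬ (Q.coeff (Q.natDegree - 1)).IsRoot a))
    (p : Polynomial ℂ) (hd : 2 ≤ p.natDegree) :
    UnprojectedDense {w : Fin 2 ⊕ Fin 2 → ℂ | w (Sum.inl 1) = p.eval (w (Sum.inl 0)) ∧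
      MvPolynomial.eval ![w (Sum.inl 0), w (Sum.inr 0)] P = 0} := by
  classical
  by_contra hnot
  have hQirr : Irreducible Q := (irreducible_rows_iff hP).1 hirr
  have hQ1 : Q.natDegree ≠ 0 := fun h =>
    natDegree_ne_zero_of_isRoot hT0 hTθ (Nat.le_zero.1 (h ▸ natDegree_topRow_le Q N T hT))
  -- the branch at infinity through `θ` and its algebraic logarithm (file XXVII)
  obtain ⟨ψ, δ, hδ, -, -, hψball, hψroot, -, hψalg⟩ :=
    exists_algebraic_branchLog_of_not_dense Q hP hirr N hN T hT hT0 hθ0 hTθ hT'θ p hd hnot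
  -- a large point
  set z₀ : ℂ := ((δ⁻¹ + 1 : ℝ) : ℂ) with hz₀def
  have hz₀ : δ⁻¹ < ‖z₀‖ := by
    rw [hz₀def, Complex.norm_real, Real.norm_eq_abs, abs_of_pos (by positivity)]; linarith
  have hgood : ∀ z : ℂ, δ⁻¹ < ‖z‖ → z ≠ 0 ∧ ‖z⁻¹‖ < δ := by
    intro z hz
    have hzpos : 0 < ‖z‖ := lt_trans (by positivity) hz
    refine ⟨norm_pos_iff.1 hzpos, ?_⟩
    rw [norm_inv]
    calc ‖z‖⁻¹ < (δ⁻¹)⁻¹ := (inv_lt_inv₀ hzpos (by positivity)).2 hz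
      _ = δ := inv_inv δ
  have hnear : ∀ᶠ y in 𝓝 z₀, δ⁻¹ < ‖y‖ :=
    (continuous_norm.continuousAt (x := z₀)).eventually (lt_mem_nhds hz₀)
  obtain ⟨hLan, hLalg⟩ := hψalg z₀ hz₀
  -- the branch `ρ(z) = ψ(1/z)`
  set ρ : ℂ → ℂ := fun z => ψ z⁻¹ with hρ
  have hρfacts : ∀ z : ℂ, δ⁻¹ < ‖z‖ → AnalyticAt ℂ ρ z ∧ ρ z ≠ 0 ∧ ρ z / θ ∈ Complex.slitPlane ∧
      (Q.map (Polynomial.evalRingHom z)).eval (ρ z) = 0 := by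
    intro z hz
    obtain ⟨hz0, hzu⟩ := hgood z hz
    obtain ⟨han, hne, hslit⟩ := hψball z⁻¹ hzu
    have hroot := hψroot z⁻¹ hzu (inv_ne_zero hz0)
    rw [inv_inv] at hroot
    exact ⟨han.comp (analyticAt_inv hz0), hne, hslit, hroot⟩
  have hρan : AnalyticAt ℂ ρ z₀ := (hρfacts z₀ hz₀).1
  have hρ0 : ρ z₀ ≠ 0 := (hρfacts z₀ hz₀).2.1
  have hQρ : ∀ᶠ z in 𝓝 z₀, (Q.map (Polynomial.evalRingHom z)).eval (ρ z) = 0 := by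
    filter_upwards [hnear] with z hz using (hρfacts z hz).2.2.2
  -- `log(ρ/θ)' = ρ'/ρ`
  have hL : ∀ᶠ z in 𝓝 z₀, HasDerivAt (fun y => Complex.log (ψ y⁻¹ / θ)) (deriv ρ z / ρ z) z := by
    filter_upwards [hnear] with z hz
    obtain ⟨han, hne, hslit, -⟩ := hρfacts z hz
    have hρd : HasDerivAt ρ (deriv ρ z) z := han.differentiableAt.hasDerivAt
    have hlog := (hρd.div_const θ).clog hslit
    refine hlog.congr_deriv ?_
    rw [div_div_div_cancel_right₀ hθ0]
  rcases hpt with ⟨a, ha, ha'⟩ | ⟨hQ00, a, ha, ha'⟩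
  · exact not_isAlgebraic_log_algebraicBranch_zero Q hQirr hQ1 ha ha' hρan hLan hρ0 hQρ hL hLalg
  · exact not_isAlgebraic_log_algebraicBranch_pole Q hQirr hQ1 hQ00 ha ha' hρan hLan hρ0 hQρ hL hLalg

/-! ## The reciprocal-type fibres of `y₀`-degree `3` -/

/-- In an irreducible `Q ∈ ℂ[s][t]` of positive `t`-degree the rows have no common root. [folklore] -/
theorem exists_coeff_not_isRoot_of_irreducible {Q : Polynomial (Polynomial ℂ)} (hQirr : Irreducible Q)
    (hQ1 : Q.natDegree ≠ 0) (a : ℂ) : ∃ j, ¬ (Q.coeff j).IsRoot a := by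
  by_contra hall
  push Not at hall
  -- `(s - a)` divides every row, hence `C (X - C a) ∣ Q`
  have hdvd : Polynomial.C (Polynomial.X - Polynomial.C a) ∣ Q := by
    rw [Polynomial.C_dvd_iff_dvd_coeff]
    intro j
    exact Polynomial.dvd_iff_isRoot.2 (hall j)
  obtain ⟨S, hS⟩ := hdvd
  rcases hQirr.isUnit_or_isUnit hS with hu | hu
  · rw [Polynomial.isUnit_C, Polynomial.isUnit_iff_degree_eq_zero, Polynomial.degree_X_sub_C] at hu
    exact one_ne_zero hu
  · obtain ⟨r, hr, hrS⟩ := Polynomial.isUnit_iff.1 hu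
    apply hQ1
    rw [hS, ← hrS, Polynomial.natDegree_mul (Polynomial.C_ne_zero.2 (Polynomial.X_sub_C_ne_zero a))
      (Polynomial.C_ne_zero.2 hr.ne_zero), Polynomial.natDegree_C, Polynomial.natDegree_C]

/-- **Every irreducible reciprocal-type fibre of `y₀`-degree `3` with a simple nonzero top-row root is
dense over polynomial graphs of degree `≥ 2`.**  `Q = q₃ t³ + q₂ t² + q₁ t + c·q₃` (`q₃` with a root);
at a root `a` of `q₃`, irreducibility gives `q₁(a) ≠ 0` (an unramified zero) or `q₂(a) ≠ 0` (an
unramified pole).  [cite: MantovaMasser2023, §1 Further remarks, p. 5 (the question, open in general)]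
(new) -/
theorem unprojectedDense_graph_reciprocalCubic (Q : Polynomial (Polynomial ℂ))
    {P : MvPolynomial (Fin 2) ℂ}
    (hP : ∀ x y : ℂ, MvPolynomial.eval ![x, y] P = (Q.map (Polynomial.evalRingHom x)).eval y)
    (hirr : Irreducible P) (hQ3 : Q.natDegree = 3) {c : ℂ} (hc : c ≠ 0)
    (hrec : Q.coeff 0 = Polynomial.C c * Q.coeff 3) {a : ℂ} (ha : (Q.coeff 3).IsRoot a)
    (N : ℕ) (hN : ∀ j, (Q.coeff j).natDegree ≤ N) (T : Polynomial ℂ)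
    (hT : ∀ j, T.coeff j = (Q.coeff j).coeff N) (hT0 : T ≠ 0) {θ : ℂ} (hθ0 : θ ≠ 0)
    (hTθ : T.IsRoot θ) (hT'θ : (Polynomial.derivative T).eval θ ≠ 0)
    (p : Polynomial ℂ) (hd : 2 ≤ p.natDegree) :
    UnprojectedDense {w : Fin 2 ⊕ Fin 2 → ℂ | w (Sum.inl 1) = p.eval (w (Sum.inl 0)) ∧
      MvPolynomial.eval ![w (Sum.inl 0), w (Sum.inr 0)] P = 0} := by
  classical
  have hQirr : Irreducible Q := (irreducible_rows_iff hP).1 hirr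
  have hQ1 : Q.natDegree ≠ 0 := by rw [hQ3]; norm_num
  have h0a : (Q.coeff 0).IsRoot a := by
    rw [hrec, Polynomial.IsRoot, Polynomial.eval_mul, Polynomial.eval_C, ha.eq_zero, mul_zero]
  have hq3 : Q.coeff 3 ≠ 0 := by
    rw [← hQ3]; exact Polynomial.leadingCoeff_ne_zero.2 hQirr.ne_zero
  have hQ00 : Q.coeff 0 ≠ 0 := by
    rw [hrec]; exact mul_ne_zero (Polynomial.C_ne_zero.2 hc) hq3
  refine unprojectedDense_graph_unramifiedBranch Q hP hirr N hN T hT hT0 hθ0 hTθ hT'θ ?_ p hd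
  by_cases h1 : (Q.coeff 1).IsRoot a
  · refine Or.inr ⟨hQ00, a, by rw [hQ3]; exact ha, ?_⟩
    rw [hQ3]
    intro h2
    obtain ⟨j, hj⟩ := exists_coeff_not_isRoot_of_irreducible hQirr hQ1 a
    have hjle : j ≤ 3 := by
      by_contra hlt
      apply hj
      rw [Polynomial.coeff_eq_zero_of_natDegree_lt (by rw [hQ3]; omega)]
      exact Polynomial.IsRoot.def.2 (Polynomial.eval_zero)
    interval_cases j
    · exact hj h0a
    · exact hj h1
    · exact hj h2
    · exact hj ha
  · exact Or.inl ⟨a, h0a, h1⟩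

end Summit.Schanuel.Schanuel.Theorems
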